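import Summits.QuantumFields.YangMills.Theorems.UnitScaleTiltProp7PinnedFlatCoercivity
import HarnessLib

/-!
# N8 (file 1 of 3) — THE LINEAR FLAT CORE OF STUB (P) WITH AN AVERAGING SOURCE:
# `Σ_b ‖Y(b)‖²_F ≤ C₁(L,N)·(L^k)²·Σ_p ‖(∂Y)(p)‖²_F + 28·L^k·Σ_c ‖(Q^{(k)}Y)(c)‖²_F` for `∂^*Y` supported on the `k`-centres, `Q^{(k)}Y` ARBITRARY
(route R of crux K1 «MinimiserStabilityRegPr», stmt-QuantumFields-19200; W-SEAT MAP #3 row M8 «N8 = N7-inhomogeneous»; cell `ym3-torus`, width seat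
`ym-ust-19200-w1` g5 = routeR-w1; `--supports stmt-QuantumFields-19200 --as helper`, count-neutral)

YM₃ on T³ is a RUNG of the ladder (R3), not the Clay problem; nothing here claims the stub, the crux or the gap.

WHY.  N7 (✓ p600443, `Prop7PinnedFlatCoercivity.sum_normSq_le_curl_normSq_of_pinned`) is the homogeneous statement `Q^{(k)}Y = 0`.  The nonlinear
passage (CARD-19200-V3-g11 §6 (S3)∕(S3′), MAP #3 M10) produces a field whose TRUE linearised k-fold average is not zero but a quadratic defect
(M10(b)); the assembly therefore needs the constraint as a SOURCE.  The power of `L^k` on that source is forced: the constant field `Y ≡ E` on the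
`μ`-bonds has `∂Y = 0`, `∂^*Y = 0`, `Q^{(k)}Y = L^k·E`, and `Σ_b‖Y‖² ∕ Σ_c‖Q^{(k)}Y‖² = L^k` (d = 3).

WHAT IS PROVED (sorry-free, no definition; `d = 3`, lattice factor `1`, `M_N(ℂ)`-valued bond fields, Frobenius sums, `Q^{(k)}` an ABSTRACT composite of
`linAvg` given by `hQ0`, `hQs`):
* §1 `constraint_on_hodge_parts_src` — p598664's identity WITHOUT the hypothesis `Q^{(k)}Y = 0`: for `Y = B + ∂φ` and every recursion family `Λ_B` of `B`,
  `L^k·(Q_kB)(c) + (φ(embIter k c₊) − φ(embIter k c₋)) = Λ_B(c₊) − Λ_B(c₋) + (Q^{(k)}Y)(c)`; `exists_constraint_on_hodge_parts_bound_src` — with N6's bound on `Λ_B`.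
* §2 `component_bound_src` — p600443's `component_bound` with the source: the coarse datum of part 1's `sum_sq_add_grad_sq_le_of_component` is
  `r = π(Λ(c₊) − Λ(c₋) + (Q^{(k)}Y)(c))`, and `r² ≤ 2π(Λ(c₊) − Λ(c₋))² + 2π((Q^{(k)}Y)(c))²`.
* §3 ★★ `sum_normSq_le_curl_add_avg_of_pinned (hd : P.d = 3) (Q) (hQ0) (hQs) (Y) (hk : k ≤ m + K) (hpin : ∂^*Y = 0 off Set.range (embIter k))` :
  `Σ_b Σ_{a,b′} |Y(b)_{ab′}|² ≤ (8400·N²·L⁴/(√L − 1)² + 97/8)·(L^k)²·Σ_p Σ_{a,b′} |(∂Y)(p)_{ab′}|² + 28·L^k·Σ_c Σ_{a,b′} |(Q^{(k)}Y)(c)_{ab′}|²`;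
  `…_of_pinned'` (pointwise pinning hypothesis) and `…_T3` (run `K` of a T³ family, `k = K − n`).

PROOF.  Verbatim the N7 assembly (Steps 2, 3, 6 of CARD §5) with the coarse datum `r = ∇Λ_B + Q^{(k)}Y`: `Σ r² ≤ 2Σ(∇Λ)² + 2Σ(Q^{(k)}Y)²` doubles the
N6 constant (`4200 → 8400`) and adds `2·14·L^k·Σ_c‖(Q^{(k)}Y)(c)‖²_F`.
-/

set_option autoImplicit false

noncomputable section

open scoped BigOperators Matrix.Norms.L2Operator Matrix

namespace Summit.QuantumFields.YangMills.Theorems.Prop7PinnedFlatCoercivitySrc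

open Literature.MathematicalPhysics.QuantumFieldTheory.Balaban1983to89
open Finset T4Continuum BlockAveraging BlockAveragingEMLLinearised LatticeFieldCalculus
open B15DeterminingSets (embIter)
open B10StarCount (sum_pbond)
open B5Eq120IterProof (bondAvgIter_grad)
open Literature.MathematicalPhysics.QuantumFieldTheory.BalabanImbrieJaffe1984to88.BIJ85AxialPropagator411 (bondAvgIter_add)
open Summit.QuantumFields.YangMills.Theorems.Prop7IterLinStructureRec (iterLin_eq_of_iterLambda exists_iterLambda iterLambda_grad)
open Summit.QuantumFields.YangMills.Theorems.Prop7IterLambdaBound (norm_sq_iterLambda_le)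
open Summit.QuantumFields.YangMills.Theorems.Prop7PinnedConstraintSplit (iterLambda_add)
open Summit.QuantumFields.YangMills.Theorems.Prop7PinnedFlatCoercivity (sum_comm₃ map_grad map_diverg map_curl map_bondAvgIter
  sum_sq_add_grad_sq_le_of_component exists_reEntry exists_imEntry sum_normSq_le_mul_opNorm_sq sum_normSq_sub_le sum_pbond_tgt_add_src
  sum_blockEnergy_le sum_grad_normSq_eq_curl_normSq)

variable {P : Params}

/-! ## §1 The true constraint read on the Hodge parts, with the averaging source kept -/

section Constraint

variable {n : Type*} [Fintype n] [DecidableEq n] [Nonempty n]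

omit [Fintype n] [DecidableEq n] [Nonempty n] in
/-- **THE TRUE CONSTRAINT ON THE HODGE PARTS, WITH SOURCE**: let `Y = B + ∂φ` bond-wise and `Q^{(k)}` the composite of `linAvg` (`k ≤ m + K`); then for
every recursion family `Λ_B` for `B` and every level-`k` bond `c`,
`L^k·(Q_kB)(c) + (φ(embIter k c₊) − φ(embIter k c₋)) = Λ_B(c₊) − Λ_B(c₋) + (Q^{(k)}Y)(c)`. [cite: Balaban1984PropagatorsI, (1.18)-(1.20) pp.19-20] -/
theorem constraint_on_hodge_parts_src
    (Q : (i : ℕ) → (PBond P 0 → Matrix n n ℂ) → PBond P i → Matrix n n ℂ)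
    (hQ0 : ∀ Y, Q 0 Y = Y) (hQs : ∀ (i : ℕ) (Y : PBond P 0 → Matrix n n ℂ) (c : PBond P (i + 1)), Q (i + 1) Y c = linAvg (Q i Y) c)
    (Y B : PBond P 0 → Matrix n n ℂ) (φ : Site P 0 → Matrix n n ℂ) (hY : ∀ b, Y b = B b + (φ b.tgt - φ b.src))
    {k : ℕ} (hk : k ≤ P.m + P.K)
    (ΛB : (k : ℕ) → Site P k → Matrix n n ℂ) (hΛB0 : ∀ y, ΛB 0 y = 0)
    (hΛBs : ∀ (k : ℕ) (y : Site P (k + 1)), ΛB (k + 1) y = (P.L ^ k : ℕ) • combMean (bondAvgIter k B) y + ΛB k (emb y))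
    (c : PBond P k) :
    (P.L ^ k : ℕ) • bondAvgIter k B c + (φ (embIter k c.tgt) - φ (embIter k c.src)) = ΛB k c.tgt - ΛB k c.src + Q k Y c := by
  -- a recursion family for the pure gauge `∂φ`, and the sum family for `Y`
  obtain ⟨Λφ, hΛφ0, hΛφs⟩ := exists_iterLambda (P := P) (fun b : PBond P 0 => φ b.tgt - φ b.src)
  obtain ⟨hS0, hSs⟩ := iterLambda_add B (fun b : PBond P 0 => φ b.tgt - φ b.src) ΛB Λφ hΛB0 hΛBs hΛφ0 hΛφs
  have hYfun : Y = fun b => B b + (φ b.tgt - φ b.src) := funext hY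
  -- the identity for `Y`
  have hid := iterLin_eq_of_iterLambda Q hQ0 hQs Y (fun k y => ΛB k y + Λφ k y) hS0 (by
    intro k' y; rw [hYfun]; exact hSs k' y) k hk c
  -- `Λ_φ = Q′φ − φ∘embIter`, `L^k Q_k(∂φ) = ∂(Q′_kφ)`
  have hφ := iterLambda_grad φ Λφ hΛφ0 hΛφs k hk
  have hQφ : (P.L ^ k : ℕ) • bondAvgIter k (fun b : PBond P 0 => φ b.tgt - φ b.src) c = siteAvgIter k φ c.tgt - siteAvgIter k φ c.src := by
    have hg : (fun b : PBond P 0 => φ b.tgt - φ b.src) = grad 1 φ := by funext b; simp [grad]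
    rw [hg, bondAvgIter_grad k hk 1 φ]
    simp only [grad, one_div]
    rw [← Nat.cast_smul_eq_nsmul ℝ, smul_smul]
    have hL : ((P.L : ℝ) ^ k) ≠ 0 := pow_ne_zero _ (Nat.cast_ne_zero.mpr P.L_pos.ne')
    have hone : ((P.L ^ k : ℕ) : ℝ) * ((P.L : ℝ) ^ k)⁻¹ = 1 := by push_cast; exact mul_inv_cancel₀ hL
    rw [hone, one_smul]
  have hQsum : bondAvgIter k Y c = bondAvgIter k B c + bondAvgIter k (fun b : PBond P 0 => φ b.tgt - φ b.src) c := by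
    rw [hYfun]
    have := congrFun (bondAvgIter_add (P := P) k B (fun b : PBond P 0 => φ b.tgt - φ b.src)) c
    exact this
  rw [hQsum, smul_add, hQφ, hφ c.tgt, hφ c.src] at hid
  -- `hid : Q k Y c = L^k Q_kB c + (Q′φ tgt − Q′φ src) − ((ΛB tgt + (Q′φ tgt − φ(emb tgt))) − (ΛB src + (Q′φ src − φ(emb src))))`
  rw [hid]
  abel

/-- **WITH THE `(H¹)^*`-BOUND (d = 3, `M_N(ℂ)` values)**: under the hypotheses of `constraint_on_hodge_parts_src` there is a coarse site function `Λ_B`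
with the identity `L^k·(Q_kB)(c) + (φ(embIter k c₊) − φ(embIter k c₋)) = Λ_B(c₊) − Λ_B(c₋) + (Q^{(k)}Y)(c)` AND
`‖Λ_B(y)‖² ≤ ((d+2)L)²·N·L²·(L^k/(√L−1)²)·E_k(B)(y)` at every `k`-block (`Prop7IterLambdaBound.norm_sq_iterLambda_le`). [cite: Balaban1984PropagatorsI, (1.18)-(1.20) pp.19-20] -/
theorem exists_constraint_on_hodge_parts_bound_src {N : ℕ} [NeZero N] (hd : P.d = 3)
    (Q : (i : ℕ) → (PBond P 0 → Matrix (Fin N) (Fin N) ℂ) → PBond P i → Matrix (Fin N) (Fin N) ℂ)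
    (hQ0 : ∀ Y, Q 0 Y = Y) (hQs : ∀ (i : ℕ) (Y : PBond P 0 → Matrix (Fin N) (Fin N) ℂ) (c : PBond P (i + 1)), Q (i + 1) Y c = linAvg (Q i Y) c)
    (Y B : PBond P 0 → Matrix (Fin N) (Fin N) ℂ) (φ : Site P 0 → Matrix (Fin N) (Fin N) ℂ) (hY : ∀ b, Y b = B b + (φ b.tgt - φ b.src))
    {k : ℕ} (hk : k ≤ P.m + P.K) :
    ∃ ΛB : Site P k → Matrix (Fin N) (Fin N) ℂ,
      (∀ c : PBond P k, (P.L ^ k : ℕ) • bondAvgIter k B c + (φ (embIter k c.tgt) - φ (embIter k c.src)) = ΛB c.tgt - ΛB c.src + Q k Y c) ∧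
      ∀ y : Site P k, ‖ΛB y‖ ^ 2 ≤ ((((P.d + 2) * P.L : ℕ) : ℝ) ^ 2 * N * (P.L : ℝ) ^ 2 * ((P.L : ℝ) ^ k / (Real.sqrt P.L - 1) ^ 2)) *
        ∑ μ : Fin P.d, ∑ ν : Fin P.d, ∑ x ∈ univ.filter (fun x : Site P 0 => Site.proj k k x = y),
          (if Site.proj k k (x.shift ν) = y then ‖B ⟨x.shift ν, μ⟩ - B ⟨x, μ⟩‖ ^ 2 else 0) := by
  obtain ⟨ΛB, h0, hs⟩ := exists_iterLambda (P := P) B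
  exact ⟨ΛB k, fun c => constraint_on_hodge_parts_src Q hQ0 hQs Y B φ hY hk ΛB h0 hs c,
    fun y => norm_sq_iterLambda_le hd B ΛB h0 hs hk y⟩

end Constraint

/-! ## §2 One reading of the matrix Hodge parts, with source -/

variable {N : ℕ}

/-- **ONE READING OF THE MATRIX HODGE PARTS, WITH SOURCE** (Steps 4–5 through an `ℝ`-linear reading `π`): for `B = Y − ∂φ` with `∂^*B = 0`, the matrix
constraint with source `q` and the Dirichlet principle for `π ∘ φ`, part 1's component bound reads
`Σ_b π(B(b))² + Σ_b (∂(π∘φ))(b)² ≤ 28L^k·Σ_c π(Λ(c₊) − Λ(c₋))² + 28L^k·Σ_c π(q(c))² + (97/8)(L^k)²·Σ_p π((∂Y)(p))²` (`∂B = ∂Y`).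
[cite: Balaban1984PropagatorsI, Prop. 1.1 (1.90) p.33; Balaban1985Variational, Prop. 7 p.299] -/
theorem component_bound_src (hd : P.d = 3) {k : ℕ} (hk : k ≤ P.m + P.K) (π : Matrix (Fin N) (Fin N) ℂ →ₗ[ℝ] ℝ)
    (Y : PBond P 0 → Matrix (Fin N) (Fin N) ℂ) (φ : Site P 0 → Matrix (Fin N) (Fin N) ℂ) (Λ : Site P k → Matrix (Fin N) (Fin N) ℂ)
    (q : PBond P k → Matrix (Fin N) (Fin N) ℂ)
    (hcoul : diverg 1 (fun e => Y e - grad 1 φ e) = 0)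
    (hC1 : ∀ c : PBond P k, (P.L ^ k : ℕ) • bondAvgIter k (fun e => Y e - grad 1 φ e) c + (φ (embIter k c.tgt) - φ (embIter k c.src))
      = Λ c.tgt - Λ c.src + q c)
    (hmin : ∀ ψ : SiteField P 0 ℝ, (∀ x ∈ Set.range (embIter k), ψ x = π (φ x)) →
      ∑ b : PBond P 0, grad 1 (fun x => π (φ x)) b ^ 2 ≤ ∑ b : PBond P 0, grad 1 ψ b ^ 2) :
    ∑ b : PBond P 0, π (Y b - grad 1 φ b) ^ 2 + ∑ b : PBond P 0, grad 1 (fun x => π (φ x)) b ^ 2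
      ≤ 28 * (P.L : ℝ) ^ k * ∑ c : PBond P k, π (Λ c.tgt - Λ c.src) ^ 2 + 28 * (P.L : ℝ) ^ k * ∑ c : PBond P k, π (q c) ^ 2
        + (97 / 8) * ((P.L : ℝ) ^ k) ^ 2 * ∑ p : Plaq P 0, π (curl 1 Y p) ^ 2 := by
  have hdiv : diverg 1 (fun e => π (Y e - grad 1 φ e)) = 0 := by
    funext x
    rw [Pi.zero_apply, ← map_diverg π _ x, congrFun hcoul x, Pi.zero_apply, map_zero]
  have hC1' : ∀ c : PBond P k, (P.L : ℝ) ^ k * bondAvgIter k (fun e => π (Y e - grad 1 φ e)) c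
      + (π (φ (embIter k c.tgt)) - π (φ (embIter k c.src))) = π (Λ c.tgt - Λ c.src + q c) := by
    intro c
    have hc := congrArg π (hC1 c)
    rw [map_add, map_nsmul, map_bondAvgIter π hk, map_sub, nsmul_eq_mul] at hc
    push_cast at hc
    exact hc
  have hmain := sum_sq_add_grad_sq_le_of_component hd hk (fun e => π (Y e - grad 1 φ e)) (fun x => π (φ x))
    (fun c => π (Λ c.tgt - Λ c.src + q c)) hdiv hC1' hmin
  have hcurl : ∀ p : Plaq P 0, curl 1 (fun e => π (Y e - grad 1 φ e)) p = π (curl 1 Y p) := fun p => by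
    rw [← map_curl π _ p]
    exact congrArg π (curl_gaugeShift 1 1 φ Y p)
  simp only [hcurl] at hmain
  -- `r² ≤ 2(∇Λ)² + 2q²`
  have hr : ∑ c : PBond P k, π (Λ c.tgt - Λ c.src + q c) ^ 2
      ≤ 2 * ∑ c : PBond P k, π (Λ c.tgt - Λ c.src) ^ 2 + 2 * ∑ c : PBond P k, π (q c) ^ 2 := by
    rw [Finset.mul_sum, Finset.mul_sum, ← Finset.sum_add_distrib]
    refine Finset.sum_le_sum fun c _ => ?_
    rw [map_add]
    nlinarith [sq_nonneg (π (Λ c.tgt - Λ c.src) - π (q c))]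
  have hℓ0 : 0 ≤ 14 * (P.L : ℝ) ^ k := by positivity
  have h2 := mul_le_mul_of_nonneg_left hr hℓ0
  linarith [hmain, h2]

/-! ## §3 The assembly with source -/

/-- ★★ **P-LIN-FLAT, PINNED, WITH AVERAGING SOURCE** (`d = 3`): for an `M_N(ℂ)`-valued bond field `Y` on the finest torus with `∂^*Y` supported on the
`k`-centres `embIter k y`, and `Q^{(k)}` ANY composite of the linearised average (no constraint assumed),
`Σ_b ‖Y(b)‖²_F ≤ (8400·N²·L⁴/(√L − 1)² + 97/8)·(L^k)²·Σ_p ‖(∂Y)(p)‖²_F + 28·L^k·Σ_c ‖(Q^{(k)}Y)(c)‖²_F` — uniformly in `k` and in the volume; the power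
`L^k` on the source is sharp (constant fields). [cite: Balaban1984PropagatorsI, Prop. 1.1 (1.90) p.33; Balaban1985Variational, Prop. 7 p.299, (141)-(143) p.299] -/
theorem sum_normSq_le_curl_add_avg_of_pinned (hd : P.d = 3) [NeZero N]
    (Q : (i : ℕ) → (PBond P 0 → Matrix (Fin N) (Fin N) ℂ) → PBond P i → Matrix (Fin N) (Fin N) ℂ)
    (hQ0 : ∀ Y, Q 0 Y = Y)
    (hQs : ∀ (i : ℕ) (Y : PBond P 0 → Matrix (Fin N) (Fin N) ℂ) (c : PBond P (i + 1)), Q (i + 1) Y c = linAvg (Q i Y) c)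
    (Y : PBond P 0 → Matrix (Fin N) (Fin N) ℂ) {k : ℕ} (hk : k ≤ P.m + P.K)
    (hpin : ∀ x : Site P 0, x ∉ Set.range (embIter k) → diverg 1 Y x = 0) :
    ∑ b : PBond P 0, ∑ a : Fin N, ∑ b' : Fin N, Complex.normSq ((Y b) a b')
      ≤ (8400 * (N : ℝ) ^ 2 * (P.L : ℝ) ^ 4 / (Real.sqrt P.L - 1) ^ 2 + 97 / 8) * ((P.L : ℝ) ^ k) ^ 2
          * ∑ p : Plaq P 0, ∑ a : Fin N, ∑ b' : Fin N, Complex.normSq ((curl 1 Y p) a b')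
        + 28 * (P.L : ℝ) ^ k * ∑ c : PBond P k, ∑ a : Fin N, ∑ b' : Fin N, Complex.normSq ((Q k Y c) a b') := by
  classical
  -- Step 2: the matrix Hodge split
  obtain ⟨φ, hcoul, -, hEid, hDirR, hDirI⟩ := Prop7MatrixHodgeSplit.exists_matrixHodgeSplit_pinned Y hpin
  have hYB : ∀ b : PBond P 0, Y b = (fun e => Y e - grad 1 φ e) b + (φ b.tgt - φ b.src) := fun b => by
    simp only [grad, one_smul, sub_add_cancel]
  -- Step 3: the constraint on the Hodge parts (with source), with the `(H¹)^*`-bounded `Λ`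
  obtain ⟨Λ, hC1, hC2⟩ := exists_constraint_on_hodge_parts_bound_src hd Q hQ0 hQs Y (fun e => Y e - grad 1 φ e) φ hYB hk
  -- letters
  have hL1 : (1 : ℝ) < P.L := by exact_mod_cast P.hL.2
  set ℓ : ℝ := (P.L : ℝ) ^ k with hℓ
  have hℓ0 : 0 < ℓ := by positivity
  set CURL : ℝ := ∑ p : Plaq P 0, ∑ a : Fin N, ∑ b' : Fin N, Complex.normSq ((curl 1 Y p) a b') with hCURL
  set QQ : ℝ := ∑ c : PBond P k, ∑ a : Fin N, ∑ b' : Fin N, Complex.normSq ((Q k Y c) a b') with hQQ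
  set R : ℝ := ∑ c : PBond P k, ∑ a : Fin N, ∑ b' : Fin N, Complex.normSq ((Λ c.tgt - Λ c.src) a b') with hR
  set c₂ : ℝ := (((P.d + 2) * P.L : ℕ) : ℝ) ^ 2 * N * (P.L : ℝ) ^ 2 * ((P.L : ℝ) ^ k / (Real.sqrt P.L - 1) ^ 2) with hc₂
  have hc₂0 : 0 ≤ c₂ := by positivity
  -- Steps 4–5 per entry, summed (Step 6a)
  have hent : ∀ a b' : Fin N,
      (∑ e : PBond P 0, Complex.normSq ((Y e - grad 1 φ e) a b') + ∑ e : PBond P 0, Complex.normSq ((grad 1 φ e) a b'))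
        ≤ 28 * ℓ * ∑ c : PBond P k, Complex.normSq ((Λ c.tgt - Λ c.src) a b')
          + 28 * ℓ * ∑ c : PBond P k, Complex.normSq ((Q k Y c) a b')
          + (97 / 8) * ℓ ^ 2 * ∑ p : Plaq P 0, Complex.normSq ((curl 1 Y p) a b') := by
    intro a b'
    obtain ⟨πr, hπr⟩ := exists_reEntry (N := N) a b'
    obtain ⟨πi, hπi⟩ := exists_imEntry (N := N) a b'
    have hminR : ∀ ψ : SiteField P 0 ℝ, (∀ x ∈ Set.range (embIter k), ψ x = πr (φ x)) →
        ∑ b : PBond P 0, grad 1 (fun x => πr (φ x)) b ^ 2 ≤ ∑ b : PBond P 0, grad 1 ψ b ^ 2 := by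
      simp only [hπr]
      simpa only [Prop7MatrixHodgeSplit.re_grad_apply] using hDirR a b'
    have hminI : ∀ ψ : SiteField P 0 ℝ, (∀ x ∈ Set.range (embIter k), ψ x = πi (φ x)) →
        ∑ b : PBond P 0, grad 1 (fun x => πi (φ x)) b ^ 2 ≤ ∑ b : PBond P 0, grad 1 ψ b ^ 2 := by
      simp only [hπi]
      simpa only [Prop7MatrixHodgeSplit.im_grad_apply] using hDirI a b'
    have hr := component_bound_src hd hk πr Y φ Λ (fun c => Q k Y c) hcoul hC1 hminR
    have hi := component_bound_src hd hk πi Y φ Λ (fun c => Q k Y c) hcoul hC1 hminI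
    simp only [hπr] at hr
    simp only [hπi] at hi
    simp only [← Prop7MatrixHodgeSplit.re_grad_apply] at hr
    simp only [← Prop7MatrixHodgeSplit.im_grad_apply] at hi
    simp only [Prop7MatrixHodgeSplit.normSq_eq_re_sq_add_im_sq, Finset.sum_add_distrib, mul_add]
    linarith [hr, hi]
  have hsum : ∑ b : PBond P 0, ∑ a : Fin N, ∑ b' : Fin N, Complex.normSq ((Y b) a b')
      ≤ 28 * ℓ * R + 28 * ℓ * QQ + (97 / 8) * ℓ ^ 2 * CURL := by
    rw [hEid, sum_comm₃ (fun (e : PBond P 0) (a b' : Fin N) => Complex.normSq ((Y e - grad 1 φ e) a b')),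
      sum_comm₃ (fun (e : PBond P 0) (a b' : Fin N) => Complex.normSq ((grad 1 φ e) a b')), hR, hQQ, hCURL,
      sum_comm₃ (fun (c : PBond P k) (a b' : Fin N) => Complex.normSq ((Λ c.tgt - Λ c.src) a b')),
      sum_comm₃ (fun (c : PBond P k) (a b' : Fin N) => Complex.normSq ((Q k Y c) a b')),
      sum_comm₃ (fun (p : Plaq P 0) (a b' : Fin N) => Complex.normSq ((curl 1 Y p) a b')),
      Finset.mul_sum, Finset.mul_sum, Finset.mul_sum, ← Finset.sum_add_distrib, ← Finset.sum_add_distrib, ← Finset.sum_add_distrib]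
    refine Finset.sum_le_sum fun a _ => ?_
    rw [Finset.mul_sum, Finset.mul_sum, Finset.mul_sum, ← Finset.sum_add_distrib, ← Finset.sum_add_distrib, ← Finset.sum_add_distrib]
    exact Finset.sum_le_sum fun b' _ => hent a b'
  -- Step 6b: `R ≤ 12·N·c₂·CURL`
  have hcurlB : ∀ p : Plaq P 0, curl 1 (fun e => Y e - grad 1 φ e) p = curl 1 Y p := fun p => curl_gaugeShift 1 1 φ Y p
  have hRle : R ≤ 12 * N * c₂ * CURL := by
    set Eb : Site P k → ℝ := fun y => ∑ μ : Fin P.d, ∑ ν : Fin P.d, ∑ x ∈ univ.filter (fun x : Site P 0 => Site.proj k k x = y),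
        (if Site.proj k k (x.shift ν) = y then
          ‖(Y ⟨x.shift ν, μ⟩ - grad 1 φ ⟨x.shift ν, μ⟩) - (Y ⟨x, μ⟩ - grad 1 φ ⟨x, μ⟩)‖ ^ 2 else 0) with hEb
    have hC2' : ∀ y : Site P k, ‖Λ y‖ ^ 2 ≤ c₂ * Eb y := fun y => by simpa only [hEb] using hC2 y
    have h1 : ∀ c : PBond P k, ∑ a : Fin N, ∑ b' : Fin N, Complex.normSq ((Λ c.tgt - Λ c.src) a b')
        ≤ 2 * N * c₂ * (Eb c.tgt + Eb c.src) := by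
      intro c
      have ht := (sum_normSq_le_mul_opNorm_sq (Λ c.tgt)).trans (mul_le_mul_of_nonneg_left (hC2' c.tgt) (Nat.cast_nonneg N))
      have hs := (sum_normSq_le_mul_opNorm_sq (Λ c.src)).trans (mul_le_mul_of_nonneg_left (hC2' c.src) (Nat.cast_nonneg N))
      have hsub := sum_normSq_sub_le (Λ c.tgt) (Λ c.src)
      have e1 : (↑N * (c₂ * Eb c.tgt) : ℝ) = N * c₂ * Eb c.tgt := by ring
      have e2 : (↑N * (c₂ * Eb c.src) : ℝ) = N * c₂ * Eb c.src := by ring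
      linarith [ht, hs, hsub]
    have h2 := Finset.sum_le_sum fun c (_ : c ∈ (Finset.univ : Finset (PBond P k))) => h1 c
    rw [← Finset.mul_sum, sum_pbond_tgt_add_src Eb, ← hR] at h2
    have h3 := sum_blockEnergy_le (P := P) (k := k) (fun e => Y e - grad 1 φ e)
    rw [sum_grad_normSq_eq_curl_normSq _ hcoul] at h3
    simp only [hcurlB] at h3
    have h3' : ∑ y : Site P k, Eb y ≤ CURL := by simpa only [hEb, hCURL] using h3
    have hd3 : (P.d : ℝ) = 3 := by exact_mod_cast hd
    rw [hd3] at h2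
    have h4 := mul_le_mul_of_nonneg_left h3' (by positivity : (0 : ℝ) ≤ 2 * N * c₂ * (2 * 3))
    linarith [h2, h4]
  -- Step 6c: the constant
  have h5L : (((P.d + 2) * P.L : ℕ) : ℝ) = 5 * P.L := by rw [hd]; push_cast; ring
  have hCURL0 : 0 ≤ CURL := Finset.sum_nonneg fun _ _ => Finset.sum_nonneg fun _ _ => Finset.sum_nonneg fun _ _ => Complex.normSq_nonneg _
  have hfin : 28 * ℓ * R ≤ 8400 * (N : ℝ) ^ 2 * (P.L : ℝ) ^ 4 / (Real.sqrt P.L - 1) ^ 2 * ℓ ^ 2 * CURL := by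
    have h := mul_le_mul_of_nonneg_left hRle (by positivity : (0 : ℝ) ≤ 28 * ℓ)
    refine h.trans (le_of_eq ?_)
    rw [hc₂, h5L]
    ring
  calc ∑ b : PBond P 0, ∑ a : Fin N, ∑ b' : Fin N, Complex.normSq ((Y b) a b')
      ≤ 28 * ℓ * R + 28 * ℓ * QQ + (97 / 8) * ℓ ^ 2 * CURL := hsum
    _ ≤ 8400 * (N : ℝ) ^ 2 * (P.L : ℝ) ^ 4 / (Real.sqrt P.L - 1) ^ 2 * ℓ ^ 2 * CURL + 28 * ℓ * QQ + (97 / 8) * ℓ ^ 2 * CURL := by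
        linarith [hfin]
    _ = (8400 * (N : ℝ) ^ 2 * (P.L : ℝ) ^ 4 / (Real.sqrt P.L - 1) ^ 2 + 97 / 8) * ℓ ^ 2 * CURL + 28 * ℓ * QQ := by ring

/-- The same with the CARD's pointwise pinning hypothesis `(∀ y, x ≠ embIter k y) → ∂^*Y(x) = 0`.
[cite: Balaban1984PropagatorsI, Prop. 1.1 (1.90) p.33; Balaban1985Variational, Prop. 7 p.299] -/
theorem sum_normSq_le_curl_add_avg_of_pinned' (hd : P.d = 3) [NeZero N]
    (Q : (i : ℕ) → (PBond P 0 → Matrix (Fin N) (Fin N) ℂ) → PBond P i → Matrix (Fin N) (Fin N) ℂ)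
    (hQ0 : ∀ Y, Q 0 Y = Y)
    (hQs : ∀ (i : ℕ) (Y : PBond P 0 → Matrix (Fin N) (Fin N) ℂ) (c : PBond P (i + 1)), Q (i + 1) Y c = linAvg (Q i Y) c)
    (Y : PBond P 0 → Matrix (Fin N) (Fin N) ℂ) {k : ℕ} (hk : k ≤ P.m + P.K)
    (hpin : ∀ x : Site P 0, (∀ y : Site P k, x ≠ embIter k y) → diverg 1 Y x = 0) :
    ∑ b : PBond P 0, ∑ a : Fin N, ∑ b' : Fin N, Complex.normSq ((Y b) a b')
      ≤ (8400 * (N : ℝ) ^ 2 * (P.L : ℝ) ^ 4 / (Real.sqrt P.L - 1) ^ 2 + 97 / 8) * ((P.L : ℝ) ^ k) ^ 2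
          * ∑ p : Plaq P 0, ∑ a : Fin N, ∑ b' : Fin N, Complex.normSq ((curl 1 Y p) a b')
        + 28 * (P.L : ℝ) ^ k * ∑ c : PBond P k, ∑ a : Fin N, ∑ b' : Fin N, Complex.normSq ((Q k Y c) a b') :=
  sum_normSq_le_curl_add_avg_of_pinned hd Q hQ0 hQs Y hk fun x hx =>
    hpin x fun y hxy => hx ⟨y, hxy.symm⟩

/-- ★ **THE T³ INSTANCE** (run `K` of a T³ family, comparison height `n`, `k = K − n`, `d = 3`): for `∂^*Y` pinned at the `(K−n)`-centres and ANY composite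
`Q^{(K−n)}` of the linearised average,
`Σ_b ‖Y(b)‖²_F ≤ (8400·N²·L⁴/(√L − 1)² + 97/8)·L^{2(K−n)}·Σ_p ‖(∂Y)(p)‖²_F + 28·L^{K−n}·Σ_c ‖(Q^{(K−n)}Y)(c)‖²_F`, uniformly in `m`, `n`, `K`.
[cite: Balaban1984PropagatorsI, Prop. 1.1 (1.90) p.33; Balaban1985Variational, Prop. 7 p.299] -/
theorem sum_normSq_le_curl_add_avg_of_pinned_T3 (F : T3ContinuumYM3Torus.T3Family) (K n : ℕ) [NeZero N]
    (Q : (i : ℕ) → (PBond (F.P K) 0 → Matrix (Fin N) (Fin N) ℂ) → PBond (F.P K) i → Matrix (Fin N) (Fin N) ℂ)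
    (hQ0 : ∀ Y, Q 0 Y = Y)
    (hQs : ∀ (i : ℕ) (Y : PBond (F.P K) 0 → Matrix (Fin N) (Fin N) ℂ) (c : PBond (F.P K) (i + 1)), Q (i + 1) Y c = linAvg (Q i Y) c)
    (Y : PBond (F.P K) 0 → Matrix (Fin N) (Fin N) ℂ)
    (hpin : ∀ x : Site (F.P K) 0, x ∉ Set.range (embIter (K - n)) → diverg 1 Y x = 0) :
    ∑ b : PBond (F.P K) 0, ∑ a : Fin N, ∑ b' : Fin N, Complex.normSq ((Y b) a b')
      ≤ (8400 * (N : ℝ) ^ 2 * (F.L : ℝ) ^ 4 / (Real.sqrt F.L - 1) ^ 2 + 97 / 8) * ((F.L : ℝ) ^ (K - n)) ^ 2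
          * ∑ p : Plaq (F.P K) 0, ∑ a : Fin N, ∑ b' : Fin N, Complex.normSq ((curl 1 Y p) a b')
        + 28 * (F.L : ℝ) ^ (K - n) * ∑ c : PBond (F.P K) (K - n), ∑ a : Fin N, ∑ b' : Fin N, Complex.normSq ((Q (K - n) Y c) a b') := by
  have hk : K - n ≤ (F.P K).m + (F.P K).K := by
    have := F.hm
    show K - n ≤ F.m + K
    omega
  exact sum_normSq_le_curl_add_avg_of_pinned (P := F.P K) (T3ContinuumYM3Torus.T3Family.P_d F K) Q hQ0 hQs Y hk hpin

end Summit.QuantumFields.YangMills.Theorems.Prop7PinnedFlatCoercivitySrc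

end
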